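import Summits.KontsevichZagierPeriods.KontsevichZagierPeriods.Theorems.SoloBlindLemniscateLine
import Summits.KontsevichZagierPeriods.KontsevichZagierPeriods.Theorems.SoloBlindSubgraph
import Summits.KontsevichZagierPeriods.KontsevichZagierPeriods.Theorems.SoloBlindPiGraphs
import HarnessLib

/-!
# Euler's lemniscate relation inside the three rules, II: the rational representations

The two halves `a = ∫₀¹ dx/√(1-x⁴)`, `b = ∫₀¹ x² dx/√(1-x⁴)` of Euler's relation `a · b = π/4`
as ℚ-RATIONAL integral representations in Kontsevich–Zagier's literal sense — subgraph areas

* `lemnA2 = [{0 < x < 1, 0 ≤ y, y²(1-x⁴) ≤ 1}, 1]`,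
  `lemnB2 = [{0 < x < 1, 0 ≤ y, y²(1-x⁴) ≤ x⁴}, 1]` —

and ONE Newton–Leibniz move each (`KZ` rule (3), primitive `y`; `subgraph_sub_lineRep`) onto
the algebraic line integrals `lemnA1`, `lemnB1` of part I. Net, in `Q = FormalRep ⧸ relations`:

* `mkQ_lemnA2 : [A₂] = ¼ β(¼,½)`, `mkQ_lemnB2 : [B₂] = ¼ β(¾,½)` (two moves each).

References: M. Kontsevich, D. Zagier, *Periods* (2001), §1.1–1.2 (rules (2), (3));
L. Euler, E605 (1786).
-/

noncomputable section

namespace Summit.KontsevichZagierPeriods.KontsevichZagierPeriods.Theorems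

open Set MeasureTheory
open Literature.ModelTheory.ExponentialFields (IsSemialgebraic isSemialgebraic_setOf_eval_pos
  isSemialgebraic_setOf_eval_le isSemialgebraic_setOf_eval_lt isSemialgebraic_setOf_eval_nonneg)
open MvPolynomial (aeval X)
open Literature.NumberTheory.Transcendental
open Literature.NumberTheory.Transcendental.KZ

namespace SoloBlind

/-! ## The two rational subgraph representations -/

/-- The region under `y = 1/√(1-x⁴)` over `(0,1)`, polynomially: `{0<x<1, 0≤y, y²(1-x⁴) ≤ 1}`. -/
def kzLemnA : Set (Fin 2 → ℝ) :=
  {z | (0 < z 0 ∧ z 0 < 1) ∧ 0 ≤ z 1 ∧ z 1 ^ 2 * (1 - z 0 ^ 4) ≤ 1}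

/-- The region under `y = x²/√(1-x⁴)` over `(0,1)`: `{0<x<1, 0≤y, y²(1-x⁴) ≤ x⁴}`. -/
def kzLemnB : Set (Fin 2 → ℝ) :=
  {z | (0 < z 0 ∧ z 0 < 1) ∧ 0 ≤ z 1 ∧ z 1 ^ 2 * (1 - z 0 ^ 4) ≤ z 0 ^ 4}

/-- Membership in `kzLemnA`, unfolded. -/
theorem mem_kzLemnA {z : Fin 2 → ℝ} :
    z ∈ kzLemnA ↔ (0 < z 0 ∧ z 0 < 1) ∧ 0 ≤ z 1 ∧ z 1 ^ 2 * (1 - z 0 ^ 4) ≤ 1 := Iff.rfl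

/-- Membership in `kzLemnB`, unfolded. -/
theorem mem_kzLemnB {z : Fin 2 → ℝ} :
    z ∈ kzLemnB ↔ (0 < z 0 ∧ z 0 < 1) ∧ 0 ≤ z 1 ∧ z 1 ^ 2 * (1 - z 0 ^ 4) ≤ z 0 ^ 4 := Iff.rfl

/-- `kzLemnA` is `ℚ`-semialgebraic. -/
theorem isSemialgebraic_kzLemnA : IsSemialgebraic ℚ kzLemnA := by
  have h0 := isSemialgebraic_setOf_eval_pos (R := ℝ) (X 0 : MvPolynomial (Fin 2) ℚ)
  have h1 := isSemialgebraic_setOf_eval_lt (R := ℝ) (X 0 : MvPolynomial (Fin 2) ℚ) 1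
  have h2 := isSemialgebraic_setOf_eval_nonneg (R := ℝ) (X 1 : MvPolynomial (Fin 2) ℚ)
  have h3 := isSemialgebraic_setOf_eval_le (R := ℝ)
    (X 1 ^ 2 * (1 - X 0 ^ 4) : MvPolynomial (Fin 2) ℚ) 1
  convert ((h0.inter h1).inter h2).inter h3 using 1
  ext z
  simp [kzLemnA, and_assoc]

/-- `kzLemnB` is `ℚ`-semialgebraic. -/
theorem isSemialgebraic_kzLemnB : IsSemialgebraic ℚ kzLemnB := by
  have h0 := isSemialgebraic_setOf_eval_pos (R := ℝ) (X 0 : MvPolynomial (Fin 2) ℚ)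
  have h1 := isSemialgebraic_setOf_eval_lt (R := ℝ) (X 0 : MvPolynomial (Fin 2) ℚ) 1
  have h2 := isSemialgebraic_setOf_eval_nonneg (R := ℝ) (X 1 : MvPolynomial (Fin 2) ℚ)
  have h3 := isSemialgebraic_setOf_eval_le (R := ℝ)
    (X 1 ^ 2 * (1 - X 0 ^ 4) : MvPolynomial (Fin 2) ℚ) (X 0 ^ 4)
  convert ((h0.inter h1).inter h2).inter h3 using 1
  ext z
  simp [kzLemnB, and_assoc]

/-- `kzLemnA` lies in the arcsine region up to the null line `y = 0`. -/
theorem kzLemnA_subset : kzLemnA ⊆ kzArcsine ∪ {z | z 1 = 0} := by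
  rintro z ⟨⟨h0, h1⟩, hy, hle⟩
  rcases hy.eq_or_lt with h | h
  · exact Or.inr h.symm
  · have hx2 : z 0 ^ 2 ≤ 1 := by nlinarith
    have hx4 : z 0 ^ 4 ≤ z 0 ^ 2 := by nlinarith [sq_nonneg (z 0)]
    refine Or.inl ⟨by nlinarith, h, ?_⟩
    nlinarith [sq_nonneg (z 1)]

/-- `kzLemnB ⊆ kzLemnA`. -/
theorem kzLemnB_subset : kzLemnB ⊆ kzLemnA := by
  rintro z ⟨hx, hy, hle⟩
  exact ⟨hx, hy, hle.trans (pow_four_lt_one hx).le⟩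

/-- The constant `1` is integrable on `kzLemnA` (finite area, no estimate of `a` needed: the
region sits inside the arcsine region of `SoloBlindPiGraphs`). -/
theorem integrableOn_one_kzLemnA : IntegrableOn (fun _ : Fin 2 → ℝ => (1 : ℝ)) kzLemnA := by
  refine (integrableOn_one_kzArcsine.union (integrableOn_const ?_)).mono_set kzLemnA_subset
  rw [BallPeeling.volume_setOf_apply_eq_const 2 (1 : Fin 2) 0]
  exact ENNReal.zero_ne_top

/-- The constant `1` is integrable on `kzLemnB`. -/
theorem integrableOn_one_kzLemnB : IntegrableOn (fun _ : Fin 2 → ℝ => (1 : ℝ)) kzLemnB :=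
  integrableOn_one_kzLemnA.mono_set kzLemnB_subset

/-- **`A₂ = [{0<x<1, 0≤y, y²(1-x⁴)≤1}, 1]`**: `a = ∫₀¹ dx/√(1-x⁴)` as a subgraph area, with
`ℚ`-rational data. -/
def lemnA2 : IntegralRep 2 :=
  ratRep kzLemnA (fun _ => 1) 1 1 isSemialgebraic_kzLemnA (fun _ _ => by simp)
    (fun _ _ => by simp) integrableOn_one_kzLemnA

/-- **`B₂ = [{0<x<1, 0≤y, y²(1-x⁴)≤x⁴}, 1]`**: `b = ∫₀¹ x²dx/√(1-x⁴)` as a subgraph area, with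
`ℚ`-rational data. -/
def lemnB2 : IntegralRep 2 :=
  ratRep kzLemnB (fun _ => 1) 1 1 isSemialgebraic_kzLemnB (fun _ _ => by simp)
    (fun _ _ => by simp) integrableOn_one_kzLemnB

/-- `A₂` has KZ's literal rational shape. -/
theorem isRational_lemnA2 : lemnA2.IsRational := isRational_ratRep

/-- `B₂` has KZ's literal rational shape. -/
theorem isRational_lemnB2 : lemnB2.IsRational := isRational_ratRep

/-- The domain of `A₂`. -/
@[simp] theorem lemnA2_domain : lemnA2.domain = kzLemnA := rfl

/-- The domain of `B₂`. -/
@[simp] theorem lemnB2_domain : lemnB2.domain = kzLemnB := rfl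

/-- The integrand of `A₂` is `1`. -/
@[simp] theorem lemnA2_integrand : lemnA2.integrand = fun _ => 1 := rfl

/-- The integrand of `B₂` is `1`. -/
@[simp] theorem lemnB2_integrand : lemnB2.integrand = fun _ => 1 := rfl

/-! ## The Newton–Leibniz moves `A₂ ≡ A₁`, `B₂ ≡ B₁` -/

/-- **Move (Newton–Leibniz): `A₂ ≡ A₁`.** -/
theorem lemnA2_sub_lemnA1 : of lemnA2 - of lemnA1 ∈ relations := by
  refine subgraph_sub_lineRep lemnA2 (fun x hx => (one_div_pos.mpr
    (sqrt_one_sub_pow_four_pos hx)).le) ?_ rfl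
  ext z
  simp only [lemnA2_domain, mem_kzLemnA, mem_setOf_eq]
  refine and_congr_right fun hx => and_congr_right fun hy => ?_
  rw [le_div_sqrt_iff (one_sub_pow_four_pos hx) hy zero_le_one, one_pow]

/-- **Move (Newton–Leibniz): `B₂ ≡ B₁`.** -/
theorem lemnB2_sub_lemnB1 : of lemnB2 - of lemnB1 ∈ relations := by
  refine subgraph_sub_lineRep lemnB2 (fun x hx => (div_pos (pow_pos hx.1 2)
    (sqrt_one_sub_pow_four_pos hx)).le) ?_ rfl
  ext z
  simp only [lemnB2_domain, mem_kzLemnB, mem_setOf_eq]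
  refine and_congr_right fun hx => and_congr_right fun hy => ?_
  rw [le_div_sqrt_iff (one_sub_pow_four_pos hx) hy (sq_nonneg _), ← pow_mul]

/-- **`[A₂] = ¼ β(¼,½)`** in `Q`: two moves (Newton–Leibniz, then `t = x⁴`). -/
theorem mkQ_lemnA2 : mkQ (of lemnA2) = (((1:ℚ) / 4 : ℚ) : K₀) • betaQ (1 / 4) (1 / 2) := by
  rw [← mkQ_lemnA1, mkQ_eq_mkQ_iff]
  exact lemnA2_sub_lemnA1

/-- **`[B₂] = ¼ β(¾,½)`** in `Q`: two moves (Newton–Leibniz, then `t = x⁴`). -/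
theorem mkQ_lemnB2 : mkQ (of lemnB2) = (((1:ℚ) / 4 : ℚ) : K₀) • betaQ (3 / 4) (1 / 2) := by
  rw [← mkQ_lemnB1, mkQ_eq_mkQ_iff]
  exact lemnB2_sub_lemnB1

/-- `value A₂ = value A₁` (`= a`). -/
theorem lemnA2_value_eq_lemnA1 : lemnA2.value = lemnA1.value := by
  have h := congrArg evalQ (mkQ_eq_mkQ_iff.mpr lemnA2_sub_lemnA1)
  simpa only [evalQ_mkQ, eval_of] using h

/-- `value B₂ = value B₁` (`= b`). -/
theorem lemnB2_value_eq_lemnB1 : lemnB2.value = lemnB1.value := by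
  have h := congrArg evalQ (mkQ_eq_mkQ_iff.mpr lemnB2_sub_lemnB1)
  simpa only [evalQ_mkQ, eval_of] using h

end SoloBlind

end Summit.KontsevichZagierPeriods.KontsevichZagierPeriods.Theorems
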